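import Summits.AtomisticToContinuum.Crystallization.Theorems.FrustratedLawDichotomyStrainedPatchHomLeafTableFoldHcp
import Summits.AtomisticToContinuum.Crystallization.Theorems.FrustratedLawDichotomyStrainedPatchHomLeafTableSoundB

/-!
# hcp table leaf checker — SOUNDNESS, part A: accumulator sums, treated/far facts, the generic gradient-class bound

decomp-a2c hand-2 g24 (crux `AperiodicFrustratedLawGap`, stmt-AtomisticToContinuum-27623; β2-hcp, critic rows 864/865).  hcp twin of hand-1's
`…HomLeafTableSoundA/B`: proof-side readings (`NH.Lz`, `NH.cls`, `NH.mag`, `LH.cZ`, `LH.wN`, `rowTH`, `dltH`), ★ `acc_sumsH` (the signed accumulator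
fields of a passing fold are sums over the treated records), `treatedH_facts`, `farBH_of_untreated`, the centre value / radius in real class
coordinates, and a GENERIC one-class gradient bound `class_boundD` (arbitrary record type and derivative reading `D`).  0 sorry; standard axioms.
`--supports stmt-AtomisticToContinuum-27623`.
-/

noncomputable section

namespace Summit.AtomisticToContinuum.Crystallization.Theorems.FrustratedLawDichotomyStrainedPatchHomLeafTableCheckHcp

open scoped BigOperators
open Literature.Analysis.ValidatedNumerics.Numerics
open Summit.AtomisticToContinuum.Crystallization.Theorems.FrustratedLawDichotomyStrainedPatchHomLeafTableCheck
  (Row QT sgnZ SCN addP addN sx absDiff addP_eq addN_eq addP_sub_addN sgnZ_mul sgnZ_sx natAbs_sgnZ abs_sgnZ absDiff_cast min_max_band SCN_eq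
   QT.findLE_none_ok)

/-! ## §1. Proof-side readings of the data -/

/-- The label of a record as a function. -/
def NH.toLab (l : NH) : Fin 3 → ℤ := ![l.b0, l.b1, l.b2]

/-- The INTEGER class functional of a record: `(b0², b1², b2², b0b1, b0b2, b1b2, 2φb0, 2φb1, 2φb2, φ)`, `φ = famZ fam`. -/
def NH.Lz (l : NH) : Fin 10 → ℤ :=
  ![l.b0 * l.b0, l.b1 * l.b1, l.b2 * l.b2, l.b0 * l.b1, l.b0 * l.b2, l.b1 * l.b2,
    famZ l.fam * (2 * l.b0), famZ l.fam * (2 * l.b1), famZ l.fam * (2 * l.b2), famZ l.fam]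

/-- The same functional read from the record's precomputed class data. -/
def NH.cls (l : NH) : Fin 10 → ℤ :=
  ![(l.m00 : ℤ), (l.m11 : ℤ), (l.m22 : ℤ), sgnZ l.s01 l.m01, sgnZ l.s02 l.m02, sgnZ l.s12 l.m12, sgnZ l.z0 l.a0, sgnZ l.z1 l.a1, sgnZ l.z2 l.a2, (l.u : ℤ)]

/-- The class magnitudes of a record. -/
def NH.mag (l : NH) : Fin 10 → ℕ := ![l.m00, l.m11, l.m22, l.m01, l.m02, l.m12, l.a0, l.a1, l.a2, l.u]

/-- The signed class centres of a leaf. -/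
def LH.cZ (k : LH) : Fin 10 → ℤ :=
  ![sgnZ k.s0 k.c0, sgnZ k.s1 k.c1, sgnZ k.s2 k.c2, sgnZ k.s3 k.c3, sgnZ k.s4 k.c4, sgnZ k.s5 k.c5, sgnZ k.s6 k.c6, sgnZ k.s7 k.c7,
    sgnZ k.s8 k.c8, sgnZ k.s9 k.c9]

/-- The class half-widths of a leaf. -/
def LH.wN (k : LH) : Fin 10 → ℕ := ![k.w0, k.w1, k.w2, k.w3, k.w4, k.w5, k.w6, k.w7, k.w8, k.w9]

/-- The ten positive gradient-class parts of an accumulator. -/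
def AccH.gP (a : AccH) : Fin 10 → ℕ := ![a.g0P, a.g1P, a.g2P, a.g3P, a.g4P, a.g5P, a.g6P, a.g7P, a.g8P, a.g9P]

/-- The ten negative gradient-class parts of an accumulator. -/
def AccH.gN (a : AccH) : Fin 10 → ℕ := ![a.g0N, a.g1N, a.g2N, a.g3N, a.g4N, a.g5N, a.g6N, a.g7N, a.g8N, a.g9N]

/-- The ten entries of a literal class-sum vector. -/
def vec10 (A0 A1 A2 A3 A4 A5 A6 A7 A8 A9 : ℕ) : Fin 10 → ℕ := ![A0, A1, A2, A3, A4, A5, A6, A7, A8, A9]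

/-- `gradPenH` as a sum over the ten classes. [formal bookkeeping] -/
theorem gradPenH_eq_sum (E A0 A1 A2 A3 A4 A5 A6 A7 A8 A9 : ℕ) (k : LH) (a : AccH) :
    gradPenH E A0 A1 A2 A3 A4 A5 A6 A7 A8 A9 k a = ∑ j : Fin 10, (absDiff (a.gP j) (a.gN j) + E * vec10 A0 A1 A2 A3 A4 A5 A6 A7 A8 A9 j) * k.wN j := by
  simp only [gradPenH, Nat.add_eq, Nat.mul_eq, Fin.sum_univ_succ, Fin.sum_univ_zero, AccH.gP, AccH.gN, vec10, LH.wN]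
  simp only [Fin.isValue, Matrix.cons_val_zero, Matrix.cons_val_succ, Fin.succ_zero_eq_one, Fin.succ_one_eq_two, Matrix.cons_val]
  ring

/-- The row used for a record (junk if none was found). -/
def rowTH (tab : QT) (k : LH) (l : NH) : Row :=
  match rowOfH tab k l with
  | some r => r
  | none => ⟨0, false, 0, false, 0, 0, 0, 0, 0⟩

/-- For a treated record the row used is the row found. [formal bookkeeping] -/
theorem rowOfH_eq_rowTH {tab : QT} {k : LH} {l : NH} (h : treatedH tab k l = true) : rowOfH tab k l = some (rowTH tab k l) := by
  obtain ⟨-, -, row, hr, -⟩ := rowOfH_of_treated h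
  unfold rowTH; rw [hr]

/-- The scaled centre offset `δ = q0 − t` of a record (junk if untreated). -/
def dltH (tab : QT) (k : LH) (l : NH) : ℕ := q0NH k l - (rowTH tab k l).t

/-- `Lz` agrees with the precomputed class data. [formal bookkeeping] -/
theorem NH.Lz_eq_cls {l : NH} (hl : l.ok = true) : l.Lz = l.cls := by
  obtain ⟨h00, h11, h22, h01, h02, h12, hz0, hz1, hz2, hu⟩ := (NH.ok_iff l).1 hl
  ext j
  fin_cases j <;> simp [NH.Lz, NH.cls, h00, h11, h22, h01, h02, h12, hz0, hz1, hz2, hu]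

/-- `|cls j| = mag j`. [formal bookkeeping] -/
theorem NH.abs_cls (l : NH) (j : Fin 10) : |l.cls j| = (l.mag j : ℤ) := by
  fin_cases j <;> simp [NH.cls, NH.mag, abs_sgnZ]

/-! ## §2. Centre value and radius in real class coordinates -/

/-- The centre value of a record in real class coordinates is `(qPosH − qNegH)/SC`. [formal bookkeeping] -/
theorem ell0H_eq {l : NH} (hl : l.ok = true) (k : LH) :
    ∑ j : Fin 10, ((l.Lz j : ℤ) : ℝ) * (((k.cZ j : ℤ) : ℝ) / SC) = ((((qPosH k l : ℕ) : ℤ) - ((qNegH k l : ℕ) : ℤ) : ℤ) : ℝ) / SC := by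
  rw [qPosH_sub_qNegH hl]
  simp only [Fin.sum_univ_succ, Fin.sum_univ_zero, NH.Lz, LH.cZ]
  simp only [Fin.isValue, Matrix.cons_val_zero, Matrix.cons_val_succ, Fin.succ_zero_eq_one, Fin.succ_one_eq_two, Matrix.cons_val]
  push_cast
  ring

/-- The radius of a record in real class coordinates is `radH/SC`. [formal bookkeeping] -/
theorem radH_real_eq {l : NH} (hl : l.ok = true) (k : LH) :
    ∑ j : Fin 10, |((l.Lz j : ℤ) : ℝ)| * (((k.wN j : ℕ) : ℝ) / SC) = (((radH k l : ℕ) : ℤ) : ℝ) / SC := by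
  rw [radH_eq hl]
  simp only [Fin.sum_univ_succ, Fin.sum_univ_zero, NH.Lz, LH.wN]
  simp only [Fin.isValue, Matrix.cons_val_zero, Matrix.cons_val_succ, Fin.succ_zero_eq_one, Fin.succ_one_eq_two, Matrix.cons_val]
  push_cast
  simp only [abs_mul_self]
  ring

/-! ## §3. What a passing leaf check says in `ℤ` -/

/-- Unpacking `finalH`. [formal bookkeeping] -/
theorem finalH_true {E A0 A1 A2 A3 A4 A5 A6 A7 A8 A9 : ℕ} {k : LH} {sμ : Bool} {aμ : ℕ} {a : AccH}
    (h : finalH E A0 A1 A2 A3 A4 A5 A6 A7 A8 A9 k sμ aμ a = true) :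
    a.ok = true ∧ lhsH E (addP sμ aμ 0) (gradPenH E A0 A1 A2 A3 A4 A5 A6 A7 A8 A9 k a) a ≤ rhsH (addN sμ aμ 0) a := by
  unfold finalH at h
  simp only [Bool.and_eq_true, Nat.ble_eq] at h
  exact h

/-- Casting a difference of two `ℕ`-valued list sums that agree termwise with an `ℤ`-valued function. [formal bookkeeping] -/
theorem cast_sum_sub_eqH (f g : NH → ℕ) (h : NH → ℤ) : ∀ (T : List NH), (∀ l ∈ T, ((f l : ℕ) : ℤ) - g l = h l) →
    (((T.map f).sum : ℕ) : ℤ) - (((T.map g).sum : ℕ) : ℤ) = (T.map h).sum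
  | [], _ => by simp
  | l :: T, hT => by
    rw [List.map_cons, List.map_cons, List.map_cons, List.sum_cons, List.sum_cons, List.sum_cons, Nat.cast_add, Nat.cast_add,
      ← hT l List.mem_cons_self, ← cast_sum_sub_eqH f g h T (fun l' hl' => hT l' (List.mem_cons_of_mem _ hl'))]
    ring

/-- ★ **THE ACCUMULATOR SUMS.**  For a passing fold, with `T` = the treated records: every record passes its step, and the signed accumulator fields are
the sums over `T` of the per-record data read from the rows used (value, centre correction, `Σδ`, ten gradient classes as `D · cls j`, curvature).
[formal bookkeeping] -/
theorem acc_sumsH {tab : QT} {k : LH} {labs : List NH} (hok : (foldH tab k accH0 labs).ok = true) :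
    (∀ l ∈ labs, stepOKH tab k l = true) ∧
    (((foldH tab k accH0 labs).vP : ℤ) - (foldH tab k accH0 labs).vN =
      ((labs.filter (fun l => treatedH tab k l)).map (fun l => sgnZ (rowTH tab k l).sV (rowTH tab k l).aV)).sum) ∧
    (((foldH tab k accH0 labs).dP : ℤ) - (foldH tab k accH0 labs).dN =
      ((labs.filter (fun l => treatedH tab k l)).map (fun l => sgnZ (rowTH tab k l).sD (rowTH tab k l).aD * (dltH tab k l : ℤ))).sum) ∧
    ((foldH tab k accH0 labs).sd = ((labs.filter (fun l => treatedH tab k l)).map (fun l => dltH tab k l)).sum) ∧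
    (∀ j : Fin 10, (((foldH tab k accH0 labs).gP j : ℕ) : ℤ) - (foldH tab k accH0 labs).gN j =
      ((labs.filter (fun l => treatedH tab k l)).map (fun l => sgnZ (rowTH tab k l).sD (rowTH tab k l).aD * l.cls j)).sum) ∧
    ((foldH tab k accH0 labs).cur = ((labs.filter (fun l => treatedH tab k l)).map
        (fun l => (rowTH tab k l).M * ((dltH tab k l + radH k l) * (dltH tab k l + radH k l)))).sum) := by
  rw [foldH_eq] at hok ⊢
  obtain ⟨-, hall, heq⟩ := foldl_stepH_eq tab k labs accH0 hok
  rw [heq]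
  set T := labs.filter (fun l => treatedH tab k l) with hT
  have hTt : ∀ l ∈ T, treatedH tab k l = true := fun l hl => (List.mem_filter.1 hl).2
  have hF := fun l (hl : l ∈ T) => incrH_fields (hTt l hl) (rowOfH_eq_rowTH (hTt l hl))
  have e0 : ∀ (P N : AccH → ℕ), (∀ a c, P (a.add c) = P a + P c) → (∀ a c, N (a.add c) = N a + N c) → P accH0 = 0 → N accH0 = 0 →
      ∀ (hfn : NH → ℤ), (∀ l ∈ T, ((P (incrH tab k l) : ℕ) : ℤ) - ((N (incrH tab k l) : ℕ) : ℤ) = hfn l) →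
      ((P (T.foldl (fun acc l => acc.add (incrH tab k l)) accH0) : ℕ) : ℤ) -
        ((N (T.foldl (fun acc l => acc.add (incrH tab k l)) accH0) : ℕ) : ℤ) = ((T.map hfn).sum : ℤ) := by
    intro P N hP hN hP0 hN0 hfn hh
    rw [proj_sub_foldlH_add P N hP hN (incrH tab k) T accH0, hP0, hN0]
    have := cast_sum_sub_eqH (fun l => P (incrH tab k l)) (fun l => N (incrH tab k l)) hfn T hh
    simp only [Nat.cast_zero, sub_zero, zero_add]
    rw [← this]
  have e1 : ∀ (P : AccH → ℕ), (∀ a c, P (a.add c) = P a + P c) → P accH0 = 0 → ∀ (hfn : NH → ℕ), (∀ l ∈ T, P (incrH tab k l) = hfn l) →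
      P (T.foldl (fun acc l => acc.add (incrH tab k l)) accH0) = ((T.map hfn).sum : ℕ) := by
    intro P hP hP0 hfn hh
    rw [proj_foldlH_add P hP (incrH tab k) T accH0, hP0, Nat.zero_add]
    exact congrArg List.sum (List.map_congr_left hh)
  refine ⟨hall, ?_, ?_, ?_, ?_, ?_⟩
  · exact e0 AccH.vP AccH.vN (fun _ _ => rfl) (fun _ _ => rfl) rfl rfl _ (fun l hl => (hF l hl).2.1)
  · exact e0 AccH.dP AccH.dN (fun _ _ => rfl) (fun _ _ => rfl) rfl rfl _ (fun l hl => (hF l hl).2.2.1)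
  · exact e1 AccH.sd (fun _ _ => rfl) rfl _ (fun l hl => (hF l hl).2.2.2.1)
  · intro j
    fin_cases j
    · exact e0 AccH.g0P AccH.g0N (fun _ _ => rfl) (fun _ _ => rfl) rfl rfl _ (fun l hl => by simpa [AccH.gP, AccH.gN, NH.cls] using (hF l hl).2.2.2.2.1)
    · exact e0 AccH.g1P AccH.g1N (fun _ _ => rfl) (fun _ _ => rfl) rfl rfl _ (fun l hl => by simpa [AccH.gP, AccH.gN, NH.cls] using (hF l hl).2.2.2.2.2.1)
    · exact e0 AccH.g2P AccH.g2N (fun _ _ => rfl) (fun _ _ => rfl) rfl rfl _ (fun l hl => by simpa [AccH.gP, AccH.gN, NH.cls] using (hF l hl).2.2.2.2.2.2.1)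
    · exact e0 AccH.g3P AccH.g3N (fun _ _ => rfl) (fun _ _ => rfl) rfl rfl _ (fun l hl => by simpa [AccH.gP, AccH.gN, NH.cls] using (hF l hl).2.2.2.2.2.2.2.1)
    · exact e0 AccH.g4P AccH.g4N (fun _ _ => rfl) (fun _ _ => rfl) rfl rfl _ (fun l hl => by simpa [AccH.gP, AccH.gN, NH.cls] using (hF l hl).2.2.2.2.2.2.2.2.1)
    · exact e0 AccH.g5P AccH.g5N (fun _ _ => rfl) (fun _ _ => rfl) rfl rfl _
        (fun l hl => by simpa [AccH.gP, AccH.gN, NH.cls] using (hF l hl).2.2.2.2.2.2.2.2.2.1)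
    · exact e0 AccH.g6P AccH.g6N (fun _ _ => rfl) (fun _ _ => rfl) rfl rfl _
        (fun l hl => by simpa [AccH.gP, AccH.gN, NH.cls] using (hF l hl).2.2.2.2.2.2.2.2.2.2.1)
    · exact e0 AccH.g7P AccH.g7N (fun _ _ => rfl) (fun _ _ => rfl) rfl rfl _
        (fun l hl => by simpa [AccH.gP, AccH.gN, NH.cls] using (hF l hl).2.2.2.2.2.2.2.2.2.2.2.1)
    · exact e0 AccH.g8P AccH.g8N (fun _ _ => rfl) (fun _ _ => rfl) rfl rfl _
        (fun l hl => by simpa [AccH.gP, AccH.gN, NH.cls] using (hF l hl).2.2.2.2.2.2.2.2.2.2.2.2.1)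
    · exact e0 AccH.g9P AccH.g9N (fun _ _ => rfl) (fun _ _ => rfl) rfl rfl _
        (fun l hl => by simpa [AccH.gP, AccH.gN, NH.cls] using (hF l hl).2.2.2.2.2.2.2.2.2.2.2.2.2.1)
  · exact e1 AccH.cur (fun _ _ => rfl) rfl _ (fun l hl => (hF l hl).2.2.2.2.2.2.2.2.2.2.2.2.2.2)

/-- The class sums of the gradient magnitudes along the treated records are bounded by the list's class sums times nothing: for the bound we
only need `Σ_T mag ≤ Σ_labs mag`. [formal bookkeeping] -/
theorem sum_mag_filter_le (labs : List NH) (p : NH → Bool) (j : Fin 10) :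
    ((labs.filter p).map (fun l => l.mag j)).sum ≤ (labs.map (fun l => l.mag j)).sum :=
  ((List.filter_sublist (l := labs) (p := p)).map _).sum_le_sum (fun _ _ => Nat.zero_le _)

/-! ## §4. Treated and far records -/

/-- A passing untreated label is far: `farBH = true`, with `radH ≤ q0NH` and `qNegH ≤ qPosH`. [formal bookkeeping] -/
theorem farBH_of_untreated {tab : QT} {k : LH} {l : NH} (hs : stepOKH tab k l = true) (ht : treatedH tab k l = false) :
    qNegH k l + radH k l ≤ qPosH k l ∧ farBH k l = true := by
  unfold stepOKH at hs; unfold treatedH at ht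
  simp only [Bool.and_eq_true, Nat.ble_eq, Bool.or_eq_true] at hs
  obtain ⟨h1, h2⟩ := hs
  refine ⟨h1, ?_⟩
  cases hf : farBH k l
  · rw [hf] at ht h2
    simp only [Nat.ble_eq_true_of_le h1, Bool.not_false, Bool.true_and, Bool.false_eq_true, false_or] at ht h2
    rw [h2] at ht; exact absurd ht (by simp)
  · rfl

/-- A treated label's arithmetic facts: `qNegH + radH ≤ qPosH`, the range test of its row, and the row is certified. [formal bookkeeping] -/
theorem treatedH_facts {tab : QT} {E : ℕ} (htab : tab.allOK E = true) {k : LH} {l : NH} (ht : treatedH tab k l = true) :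
    qNegH k l + radH k l ≤ qPosH k l ∧ (rowTH tab k l).A ≤ q0NH k l - radH k l ∧ q0NH k l + radH k l ≤ (rowTH tab k l).B ∧
      (rowTH tab k l).t ≤ q0NH k l ∧ (rowTH tab k l).ok E = true := by
  obtain ⟨h1, -, row, hr, hrange⟩ := rowOfH_of_treated ht
  have hrow : rowTH tab k l = row := by unfold rowTH; rw [hr]
  rw [hrow]
  unfold rangeBH at hrange
  simp only [Bool.and_eq_true, Nat.ble_eq] at hrange
  exact ⟨Nat.le_of_ble_eq_true h1, hrange.1.1, hrange.1.2, hrange.2, QT.findLE_none_ok htab hr⟩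

/-- FAR BY THE BOX: `81·SC ≤ 4·(q0 − r)` ⟹ the term's squared length `Σⱼ L_vⱼ xⱼ` is `≥ 81/4` for every `x` in the class box. [folklore] -/
theorem far_of_farBH {k : LH} {l : NH} (hl : l.ok = true) (h1 : qNegH k l + radH k l ≤ qPosH k l) (hfar : farBH k l = true)
    (x : Fin 10 → ℝ) (hbox : ∀ j, |x j - ((k.cZ j : ℤ) : ℝ) / SC| ≤ ((k.wN j : ℕ) : ℝ) / SC) :
    (81 : ℝ) / 4 ≤ ∑ j, ((l.Lz j : ℤ) : ℝ) * x j := by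
  have hS := SC_pos
  have hlin := Summit.AtomisticToContinuum.Crystallization.Theorems.FrustratedLawDichotomyStrainedPatchHomCentredForm.linear_mem_Icc_of_box
    (fun j => ((l.Lz j : ℤ) : ℝ)) x (fun j => ((k.cZ j : ℤ) : ℝ) / SC) (fun j => ((k.wN j : ℕ) : ℝ) / SC) hbox
  rw [ell0H_eq hl k, radH_real_eq hl k] at hlin
  have hq : (qNegH k l : ℕ) ≤ qPosH k l := le_trans (Nat.le_add_right _ _) h1
  unfold farBH q0NH at hfar
  have hfar' : 81 * SCN ≤ 4 * (qPosH k l - qNegH k l - radH k l) := by simpa [Nat.ble_eq, Nat.mul_eq] using hfar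
  have hsub : radH k l ≤ qPosH k l - qNegH k l := by omega
  have hR : (81 : ℝ) / 4 ≤ ((((qPosH k l : ℕ) : ℤ) - ((qNegH k l : ℕ) : ℤ) : ℤ) : ℝ) / SC - (((radH k l : ℕ) : ℤ) : ℝ) / SC := by
    rw [SCN_eq] at hfar'
    have : (81 : ℝ) * SC ≤ 4 * (((qPosH k l - qNegH k l - radH k l : ℕ) : ℝ)) := by exact_mod_cast hfar'
    rw [Nat.cast_sub hsub, Nat.cast_sub hq] at this
    push_cast
    rw [div_sub_div_same, le_div_iff₀ hS]
    linarith
  exact hR.trans hlin.1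

/-! ## §5. One gradient class, generically -/

/-- Casting a list sum of integers to reals (generic record type). [formal bookkeeping] -/
theorem cast_list_sum_intG {ι : Type*} (h : ι → ℤ) : ∀ (T : List ι), (T.map (fun l => ((h l : ℤ) : ℝ))).sum = (((T.map h).sum : ℤ) : ℝ)
  | [] => by simp
  | l :: T => by rw [List.map_cons, List.map_cons, List.sum_cons, List.sum_cons, cast_list_sum_intG h T]; push_cast; ring

/-- Casting a list sum of naturals to reals (generic record type). [formal bookkeeping] -/
theorem cast_list_sum_natG {ι : Type*} (h : ι → ℕ) : ∀ (T : List ι), (T.map (fun l => ((h l : ℕ) : ℝ))).sum = (((T.map h).sum : ℕ) : ℝ)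
  | [] => by simp
  | l :: T => by rw [List.map_cons, List.map_cons, List.sum_cons, List.sum_cons, cast_list_sum_natG h T]; push_cast; ring

open Classical in
/-- ★ ONE GRADIENT CLASS, GENERIC: for records `T` (no duplicates), a derivative reading `D : ι → ℤ` (scale `SC`), a coordinate functional `L` equal to
an integer class value `cls` with `|cls| = m`, the accumulator identity `GP − GN = Σ_T D·cls` and the class-sum bound `Σ_T m ≤ Ac`:
the interval-sum-before-abs gradient bound is `≤ (|GP − GN| + E·Ac)/SC`. [folklore] -/
theorem class_boundD {ι : Type*} {E : ℕ} (T : List ι) (hTnd : T.Nodup) (D : ι → ℤ) (L : ι → ℝ) (cls : ι → ℤ) (m : ι → ℕ) (GP GN Ac : ℕ)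
    (hL : ∀ l ∈ T, L l = ((cls l : ℤ) : ℝ)) (habs : ∀ l, |cls l| = (m l : ℤ))
    (eG : ((GP : ℕ) : ℤ) - GN = (T.map (fun l => D l * cls l)).sum) (hAc : (T.map m).sum ≤ Ac) :
    max |∑ l ∈ T.toFinset, min (((D l - (E : ℤ) : ℤ) : ℝ) / SC * L l) (((D l + (E : ℤ) : ℤ) : ℝ) / SC * L l)|
        |∑ l ∈ T.toFinset, max (((D l - (E : ℤ) : ℤ) : ℝ) / SC * L l) (((D l + (E : ℤ) : ℤ) : ℝ) / SC * L l)| ≤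
      ((absDiff GP GN + E * Ac : ℕ) : ℝ) / SC := by
  classical
  have hS := SC_pos
  have hE : (0:ℝ) ≤ (E : ℝ) / SC := div_nonneg (by exact_mod_cast Nat.zero_le E) hS.le
  have hband : ∀ l ∈ T.toFinset,
      min (((D l - (E : ℤ) : ℤ) : ℝ) / SC * L l) (((D l + (E : ℤ) : ℤ) : ℝ) / SC * L l) = ((D l : ℤ) : ℝ) / SC * L l - (E : ℝ) / SC * |L l| ∧
      max (((D l - (E : ℤ) : ℤ) : ℝ) / SC * L l) (((D l + (E : ℤ) : ℤ) : ℝ) / SC * L l) = ((D l : ℤ) : ℝ) / SC * L l + (E : ℝ) / SC * |L l| := by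
    intro l _
    have h := min_max_band (((D l : ℤ) : ℝ) / SC) ((E : ℝ) / SC) (L l) hE
    have e1 : ((D l - (E : ℤ) : ℤ) : ℝ) / SC = ((D l : ℤ) : ℝ) / SC - (E : ℝ) / SC := by push_cast; ring
    have e2 : ((D l + (E : ℤ) : ℤ) : ℝ) / SC = ((D l : ℤ) : ℝ) / SC + (E : ℝ) / SC := by push_cast; ring
    rw [e1, e2]; exact h
  rw [Finset.sum_congr rfl fun l hl => (hband l hl).1, Finset.sum_congr rfl fun l hl => (hband l hl).2,
    Finset.sum_sub_distrib, Finset.sum_add_distrib]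
  have hG : ∑ l ∈ T.toFinset, ((D l : ℤ) : ℝ) / SC * L l = (((GP : ℕ) : ℤ) - GN : ℝ) / SC := by
    have : ∀ l ∈ T.toFinset, ((D l : ℤ) : ℝ) / SC * L l = ((D l * cls l : ℤ) : ℝ) / SC := by
      intro l hl; rw [hL l (List.mem_toFinset.1 hl)]; push_cast; ring
    rw [Finset.sum_congr rfl this, ← Finset.sum_div, List.sum_toFinset _ hTnd, cast_list_sum_intG, ← eG]; push_cast; rfl
  have hA : ∑ l ∈ T.toFinset, (E : ℝ) / SC * |L l| = (E : ℝ) / SC * (((T.map m).sum : ℕ) : ℝ) := by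
    have : ∀ l ∈ T.toFinset, (E : ℝ) / SC * |L l| = (E : ℝ) / SC * ((m l : ℕ) : ℝ) := by
      intro l hl; rw [hL l (List.mem_toFinset.1 hl)]
      have : |((cls l : ℤ) : ℝ)| = ((m l : ℕ) : ℝ) := by rw [← Int.cast_abs, habs]; push_cast; rfl
      rw [this]
    rw [Finset.sum_congr rfl this, ← Finset.mul_sum, List.sum_toFinset _ hTnd, cast_list_sum_natG]
  rw [hG, hA]
  have hAc' : (((T.map m).sum : ℕ) : ℝ) ≤ Ac := by exact_mod_cast hAc
  have habsG : |(((GP : ℕ) : ℤ) - GN : ℝ)| = ((absDiff GP GN : ℕ) : ℝ) := by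
    have := absDiff_cast GP GN
    have : ((absDiff GP GN : ℕ) : ℝ) = ((|((GP : ℕ) : ℤ) - GN| : ℤ) : ℝ) := by exact_mod_cast this
    rw [this, Int.cast_abs]; push_cast; rfl
  have hnn : 0 ≤ (E : ℝ) / SC * (((T.map m).sum : ℕ) : ℝ) := mul_nonneg hE (by exact_mod_cast Nat.zero_le _)
  have h1 : |(((GP : ℕ) : ℤ) - GN : ℝ) / SC - (E : ℝ) / SC * (((T.map m).sum : ℕ) : ℝ)| ≤ ((absDiff GP GN : ℕ) : ℝ) / SC + (E : ℝ) / SC * Ac := by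
    refine (abs_sub _ _).trans ?_
    rw [abs_div, habsG, abs_of_pos hS, abs_of_nonneg hnn]
    have := mul_le_mul_of_nonneg_left hAc' hE
    linarith
  have h2 : |(((GP : ℕ) : ℤ) - GN : ℝ) / SC + (E : ℝ) / SC * (((T.map m).sum : ℕ) : ℝ)| ≤ ((absDiff GP GN : ℕ) : ℝ) / SC + (E : ℝ) / SC * Ac := by
    refine (abs_add_le _ _).trans ?_
    rw [abs_div, habsG, abs_of_pos hS, abs_of_nonneg hnn]
    have := mul_le_mul_of_nonneg_left hAc' hE
    linarith
  have e : ((absDiff GP GN + E * Ac : ℕ) : ℝ) / SC = ((absDiff GP GN : ℕ) : ℝ) / SC + (E : ℝ) / SC * Ac := by push_cast; ring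
  rw [e]
  exact max_le h1 h2

end Summit.AtomisticToContinuum.Crystallization.Theorems.FrustratedLawDichotomyStrainedPatchHomLeafTableCheckHcp

end
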